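import Literature.AlgebraicGeometry.ComplexMultiplication.AndreRiemannDecomposition
import Literature.AlgebraicGeometry.ComplexMultiplication.AbelianVarietyDomination
import Literature.AlgebraicGeometry.ComplexMultiplication.WeilLineClassesInWeilClassesField
import Literature.AlgebraicGeometry.HodgeTheory.AbelianVarietyHodgeFullnessHolds
import HarnessLib

/-!
# Milne 2020, Theorem 1 (= André 1992) for an ARBITRARY complex abelian variety of CM type: the record
# `HodgeTheory.Milne2020_hodgeClasses_cmType_mem_span_pullback_weilClassesField_galois` HOLDS

Part 1 (`Milne2020OfRiemannOnly`, §§1–2): the assembly of Milne's proof over an arbitrary dominating biproduct of realisations of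
CM types of one Galois CM field (`milne2020_of_avDominatedBy_biproduct`: André's product form
`HodgeTheory.Andre1992_hodgeClasses_cmTypedProduct_mem_span_pullback_weilLines_holds` on `π^* c`, pushed back by `s^*`,
targets read on the record's carriers `weilClassesField B ψ P (2p)` with `F = ℚ(a₀)`, `ψ = act(a₀)`, `P = minpoly_ℤ(a₀)` —
`Milne2020.weilLineClasses_le_weilClassesField`, `isGaloisCMFieldPoly_minpoly`), and Milne's Theorem 1 modulo Riemann's
theorem alone (`milne2020_thm1_two_lt_of_riemann_only`, `milne2020_thm1_of_riemann_only`; the domination is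
`AndreRiemann.exists_avDominatedBy_biproduct_realisations_of_riemann'`).
Part 2 (`Milne2020Holds`, §1): fed with the tree's `deligneMilne1982_Thm_6_20_full_holds`:
**`HodgeTheory.Milne2020_hodgeClasses_cmType_mem_span_pullback_weilClassesField_galois_holds`** (EXACT name) and
`milne2020_thm1_two_lt` (the degree bound `[F:ℚ] > 2`).

Milne, arXiv:2010.08857, §3 Thm. 1 [André 1992]: «Let A be a complex abelian variety of CM-type. There exist abelian varieties
A_Δ and homomorphisms f_Δ : A → A_Δ such that every Hodge class t on A can be written as a sum t = Σ f_Δ^*(t_Δ) with t_Δ a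
Weil class on A_Δ» (held text paper:arxiv-2010.08857 p. 5). No case of the Hodge conjecture is proved; the conditional
reductions `hc_cm_*` of the Summits-side files are not re-homed.

Provenance: Literature home (namespace `Literature.AlgebraicGeometry.ComplexMultiplication.Milne2020`) of §§1–2 of the Summits-side
`CorCM/Milne2020OfRiemannOnly` and §1 of `CorCM/Milne2020Holds` (imports `Literature/` and Mathlib only). Lane `lit-hodgefound`
(Layer A3/A4), seat p20.

## References
* [Milne2020HodgeClassesAV] J. S. Milne, *Hodge classes on abelian varieties* (2020), §3 Thm. 1 and proof.
* [Andre1992HodgeCM] Y. André, *Une remarque à propos des cycles de Hodge de type CM* (1992), Théorème, p. 2.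
* [DeligneMilne1982Tannakian] P. Deligne, J. S. Milne, *Tannakian categories*, LNM 900 (1982), §6 Thm. 6.20.
* [Deligne1982HodgeCycles] P. Deligne (notes by J. S. Milne), LNM 900 (1982), §4 Prop. 4.4, §5, endnote M.12.
-/

noncomputable section

namespace Literature.AlgebraicGeometry.ComplexMultiplication.Milne2020

/-! ## Part 1: the assembly over a dominating biproduct; Theorem 1 modulo Riemann's theorem -/

section Part1

open _root_.CategoryTheory _root_.CategoryTheory.Limits NumberField Polynomial
open Literature.AlgebraicGeometry Literature.AlgebraicGeometry.Motives Literature.AlgebraicGeometry.HodgeTheory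
open Literature.AlgebraicGeometry.ComplexMultiplication Literature.AlgebraicGeometry.Milne1999
open Literature.NumberTheory.Automorphic
open Literature.AlgebraicGeometry.ComplexMultiplication.Domination
open Literature.AlgebraicGeometry.ComplexMultiplication.AndreProductForm
open Literature.AlgebraicGeometry.ComplexMultiplication.AndreRiemann

/-! ## §1 The assembly over an arbitrary dominating biproduct of realisations -/

/-- **The assembly of Milne's proof from a domination by a biproduct of realisations.** If `A` is dominated
(`s ≫ π = [N]`, `N ≠ 0`) by `⨁_j B_j`, the `B_j` realising CM types `Φ_j` of a Galois CM field `F`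
(`IsCMTypeRealisation`), then for ANY integer `a₀ ∈ 𝓞_F` every rational `(p,p)` class on `A` lies in the
`ℂ`-span of `weilClassPullbacksField A (minpoly_ℤ a₀) [F:ℚ] p`: André's product form on `⨁_j B_j` applied to
`π^* c`, pushed back by `s^*` (`s^* π^* c = N^{2p} c`), each generator `f_Δ^* t` going to `(s ≫ f_Δ)^* t`
with `t ∈ W_F ⊗ ℂ` of the twisted slot product (`ψ = act(a₀)`, `P = minpoly_ℤ a₀`, `[F:ℚ] · 2p = 2 dim`).
The seat's `milne2020_of_avDominatedBy` is the case `B_j = A_{(F,Θ_j)}` (record-`h₃` realisations).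
[cite: Milne2020HodgeClassesAV, §3 Thm. 1 (proof)] [cite: Andre1992HodgeCM, Théorème] -/
theorem milne2020_of_avDominatedBy_biproduct {F : Type} [Field F] [NumberField F] [IsCMField F]
    [IsGalois ℚ F] {n : ℕ} {A' : Fin n → AbelianVariety ℂ} {Ψ : Fin n → CMType F}
    {ι' : ∀ j, 𝓞 F →+* End (A' j)} {θ' : ∀ j, F →+* Module.End ℂ (complexBetti (A' j).X 1)}
    (hA' : ∀ j, IsCMTypeRealisation (Ψ j) (A' j) (ι' j) (θ' j)) {A : AbelianVariety ℂ}
    (hdom : AVDominatedBy A (⨁ A')) (a₀ : 𝓞 F) (p : ℕ) (c : complexBetti A.X (2 * p))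
    (hcQ : IsRationalClass c) (hcH : IsOfHodgeType A.dim A.X (2 * p) p p c) :
    c ∈ Submodule.span ℂ (weilClassPullbacksField A (minpoly ℤ a₀) (Module.finrank ℚ F) p) := by
  classical
  obtain ⟨s, π, N, hN, hsπ⟩ := hdom
  -- André's product form on `⨁ A'` applied to `π^* c`
  have hc₁ := HodgeTheory.AbelianVariety.mapsTo_hodgeClasses π p ⟨hcQ, hcH⟩
  have handre := Andre1992_hodgeClasses_cmTypedProduct_mem_span_pullback_weilLines_holds F n A' Ψ ι' θ'
    hA' p (complexBetti.map π.hom.hom.hom (2 * p) c) hc₁.1 hc₁.2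
  -- push through the domination: `s^* (π^* c) = N^{2p} • c`
  set L : complexBetti (⨁ A').X (2 * p) →ₗ[ℂ] complexBetti A.X (2 * p) :=
    (complexBetti.map s.hom.hom.hom (2 * p)).hom with hL
  have hLc : L (complexBetti.map π.hom.hom.hom (2 * p) c) = ((N : ℂ) ^ (2 * p)) • c :=
    complexBetti_map_map_of_comp_eq_nsmul_id hsπ (2 * p) c
  have hmem := Submodule.apply_mem_span_image_of_mem_span L handre
  rw [hLc] at hmem
  have hNC : ((N : ℂ) ^ (2 * p)) ≠ 0 := pow_ne_zero _ (Nat.cast_ne_zero.mpr hN)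
  rw [← inv_smul_smul₀ hNC c]
  refine Submodule.smul_mem _ _ (Submodule.span_mono ?_ hmem)
  -- the image of André's generators lies in the record's `weilClassPullbacksField`
  rintro _ ⟨c', ⟨i, e, t, -, -, htQ, htH, htW, rfl⟩, rfl⟩
  let B : Fin (2 * p) → AbelianVariety ℂ := fun j => A' (i j)
  let act : ∀ j, 𝓞 F →+* End (B j) := fun j =>
    (ι' (i j)).comp (RingOfIntegers.mapRingEquiv (e j).symm).toRingHom
  refine ⟨⨁ B, (s ≫ multiDiagonal A' i).hom.hom.hom, diagHom F B act a₀, t,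
    eval₂_diagHom_minpoly F B act a₀, ?_, weilLineClasses_le_weilClassesField F B act a₀ (2 * p) htW,
    htQ, htH, ?_⟩
  · -- `[F:ℚ] · 2p = 2 dim (⨁ B)` (eigenbases of the slots count `dim H¹`)
    rw [two_mul_dim_biproduct B fun j => (exists_eigenbasis (hA' (i j))).choose, Fintype.card_fin,
      ← NumberField.Embeddings.card F ℂ, mul_comm]
  · -- `s^* (f_Δ^* t) = (s ≫ f_Δ)^* t`
    rw [complexBetti_map_comp_hom]
    rfl

/-! ## §2 Milne 2020, Theorem 1, modulo Riemann's theorem alone -/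

/-- **Milne 2020, Theorem 1, modulo Riemann's theorem ALONE — working form with the degree bound `e > 2`.**
For every complex abelian variety `A` of CM type there is ONE Galois CM field polynomial `P` of degree
`e > 2` (the minimal polynomial of a separating integer of the common Galois CM field `F ⊇ ℚ(ζ₅)` of a
dominating biproduct of CM-typed abelian varieties built from `A` by Poincaré decomposition and Shimura
inflation — `AndreRiemann.exists_avDominatedBy_biproduct_realisations_of_riemann'`) such that every rational
`(p,p)` class on `A`, for every `p`, is a `ℂ`-combination of pull-backs `g^*(w)` of rational `(p,p)` classes
`w ∈ weilClassesField B ψ P (2p)` with `P(ψ) = 0`, `e · 2p = 2 dim B`. No record other than `hR`.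
[cite: Milne2020HodgeClassesAV, §3 Thm. 1 and its proof] [cite: Deligne1982HodgeCycles, §5]
[cite: DeligneMilne1982Tannakian, §6 Thm. 6.20 (Riemann)] [cite: Shimura1998, §5.1 Props. 5–6, §6.2 Thm. 3, §18.2 Lemma] -/
theorem milne2020_thm1_two_lt_of_riemann_only (hR : DeligneMilne1982_Thm_6_20_full) (A : AbelianVariety ℂ)
    (hCM : IsOfCMType A) :
    ∃ (P : Polynomial ℤ) (e : ℕ), IsGaloisCMFieldPoly P e ∧ 2 < e ∧
      ∀ (p : ℕ) (c : complexBetti A.X (2 * p)), IsRationalClass c →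
        IsOfHodgeType A.dim A.X (2 * p) p p c → c ∈ Submodule.span ℂ (weilClassPullbacksField A P e p) := by
  obtain ⟨F, _instF, _instNF, _instCM, hGal, h2, n, B, Φ, ι, θ, hB, hdom⟩ :=
    exists_avDominatedBy_biproduct_realisations_of_riemann' hR A hCM
  haveI : IsGalois ℚ F := hGal
  obtain ⟨a₀, hsep⟩ := exists_integer_separating F
  exact ⟨minpoly ℤ a₀, Module.finrank ℚ F, isGaloisCMFieldPoly_minpoly F a₀ hsep, h2,
    fun p c hcQ hcH => milne2020_of_avDominatedBy_biproduct hB hdom a₀ p c hcQ hcH⟩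

/-- **Milne 2020, Theorem 1 (after Deligne 1982 §5 and André 1992) for EVERY complex abelian variety of CM
type — modulo Riemann's theorem `hR` (row B02) ALONE**: the Literature record
`HodgeTheory.Milne2020_hodgeClasses_cmType_mem_span_pullback_weilClassesField_galois` HOLDS under this one
displayed binder (`milne2020_thm1_two_lt_of_riemann_only`, forgetting the degree bound).
[cite: Milne2020HodgeClassesAV, §3 Thm. 1 and its proof] [cite: Andre1992HodgeCM, Théorème]
[cite: DeligneMilne1982Tannakian, §6 Thm. 6.20 (Riemann)] -/
theorem milne2020_thm1_of_riemann_only (hR : DeligneMilne1982_Thm_6_20_full) :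
    Milne2020_hodgeClasses_cmType_mem_span_pullback_weilClassesField_galois := fun A _ hCM =>
  let ⟨P, e, hP, _, h⟩ := milne2020_thm1_two_lt_of_riemann_only hR A hCM
  ⟨P, e, hP, h⟩

end Part1

/-! ## Part 2: Theorem 1 unconditionally -/

section Part2

open _root_.CategoryTheory _root_.CategoryTheory.Limits NumberField Polynomial
open Literature.AlgebraicGeometry Literature.AlgebraicGeometry.Motives Literature.AlgebraicGeometry.HodgeTheory
open Literature.AlgebraicGeometry.ComplexMultiplication Literature.AlgebraicGeometry.Milne1999
open Literature.NumberTheory.Automorphic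

/-! ## §1 Milne 2020, Theorem 1 — unconditionally -/

/-- **Milne 2020, Theorem 1 — working form with the degree bound `e > 2`, NO record.** For every complex
abelian variety `A` of CM type there is ONE Galois CM field polynomial `P` of degree `e > 2` (the minimal
polynomial of a separating integer of the common Galois CM field `F ⊇ ℚ(ζ₅)` of a dominating biproduct of
CM-typed abelian varieties built from `A` by Poincaré decomposition and Shimura inflation) such that every
rational `(p,p)` class on `A`, for every `p`, is a `ℂ`-combination of pull-backs `g^*(w)` of rational `(p,p)`
classes `w ∈ weilClassesField B ψ P (2p)` with `P(ψ) = 0`, `e · 2p = 2 dim B`: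
`milne2020_thm1_two_lt_of_riemann_only` at Riemann's theorem `deligneMilne1982_Thm_6_20_full_holds`.
[cite: Milne2020HodgeClassesAV, §3 Thm. 1 and its proof] [cite: Deligne1982HodgeCycles, §5]
[cite: DeligneMilne1982Tannakian, §6 Thm. 6.20 (Riemann)] [cite: Shimura1998, §5.1 Props. 5–6, §6.2 Thm. 3, §18.2 Lemma] -/
theorem milne2020_thm1_two_lt (A : AbelianVariety ℂ) (hCM : IsOfCMType A) :
    ∃ (P : Polynomial ℤ) (e : ℕ), IsGaloisCMFieldPoly P e ∧ 2 < e ∧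
      ∀ (p : ℕ) (c : complexBetti A.X (2 * p)), IsRationalClass c →
        IsOfHodgeType A.dim A.X (2 * p) p p c → c ∈ Submodule.span ℂ (weilClassPullbacksField A P e p) :=
  milne2020_thm1_two_lt_of_riemann_only deligneMilne1982_Thm_6_20_full_holds A hCM

/-- **Milne 2020, Theorem 1 (after Deligne 1982 §5 and André 1992) HOLDS: the Literature record
`HodgeTheory.Milne2020_hodgeClasses_cmType_mem_span_pullback_weilClassesField_galois` is a theorem** — on a
complex abelian variety of CM type every rational `(p,p)` class is a `ℂ`-combination of pull-backs of
rational `(p,p)` Weil classes relative to ONE Galois CM field («Let `F` be a CM subfield of `ℂ`, Galois over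
`ℚ`, splitting the centre of `End⁰(A)` … the subspaces `f_Δ^*(W_F(A_Δ))` span `B^p`»). Proof:
`milne2020_thm1_of_riemann_only` (p237757: André's product form on a dominating biproduct of CM-typed abelian
varieties over one Galois CM field, the biproduct built from `A` by Poincaré decomposition, Riemann's
theorem and Shimura inflation) at the tree theorem `deligneMilne1982_Thm_6_20_full_holds` (Riemann's
theorem, Deligne–Milne II Thm. 6.20). FACT DISCHARGE (binder table row M15).
[cite: Milne2020HodgeClassesAV, §3 Thm. 1 and its proof] [cite: Andre1992HodgeCM, Théorème]
[cite: DeligneMilne1982Tannakian, §6 Thm. 6.20 (Riemann)] -/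
theorem _root_.Literature.AlgebraicGeometry.HodgeTheory.Milne2020_hodgeClasses_cmType_mem_span_pullback_weilClassesField_galois_holds :
    Milne2020_hodgeClasses_cmType_mem_span_pullback_weilClassesField_galois :=
  milne2020_thm1_of_riemann_only deligneMilne1982_Thm_6_20_full_holds

end Part2

end Literature.AlgebraicGeometry.ComplexMultiplication.Milne2020

end
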